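import Summits.Ventures.QEC.CircuitDistance.ETowerKZ
import Summits.Ventures.QEC.CircuitDistance.ETowerBase
import HarnessLib

/-!
# E-fold tower ([[144,12,12]], W = 9, node K) — sector Z, slices 177–177 of `T3Z`

STEP 2 of R152 (2) (CARD-7, idea-1 g3/g4; generic port + STEP2-ASSEMBLY-SPEC type-1 g2). `T3Z` = the canonical (orbit-minimal) representatives of the
non-zero `V₃`-kernel base words of weight `≤ 9` of the extended `E(3,3)` table `TE3` (sector Z, record slot order), as ASCENDING numerals, cut into
consecutive slices `SZ_i` (`T3Z = SZ_0 ++ SZ_1 ++ …`, module `ETowerT3Z`). Per slice: the UNIT fact (§B8 (ii)) — the nested guarded tower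
`nodeA` (levels A→B→C→`ktop`) passes on `bitsOf 45 0 u` for every `u` — and the BASE-SLICE fact (§B9) — `sliceCheck` (below `2^45`, kernel word of
`tab TE3 15`, weight in `[1,9]`, orbit-minimal) and the per-weight orbit-size sums `osums`. All `decide +kernel`; predicted kernel seconds = idea-1's
`enest` K-node model. No `native_decide`. Emitted by qec-cdx-eng-1 g2 (`emit_step2.py`). Nothing here asserts a value of `d_circ`.
-/

set_option maxRecDepth 100000

namespace Summit.Ventures.QEC.CircuitDistance.ETower.SecZ

open Summit.Ventures.QEC.Census Summit.Ventures.QEC.Census.Fold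

/-- slice 177 of `T3Z`: 45 canonical base words (weights [7, 8, 9]; predicted 6.9 s on node K; s ≥ 1-rich). -/
def SZ_177 : List ℕ := [8108898260232, 8108898295968, 8108898320976, 8108903497992, 8108940198048, 8108965888080, 8109166756032, 8109435129896, 8109972006144, 8109981434112, 8110508875808, 8113193254930, 8113193418880, 8113226776704, 8113277108352, 8113730109448, 8114266964996, 8117488222736, 8117522268176, 8117756657792, 8119367237632, 8126078132484, 8126078144544, 8126084415520, 8126086512672, 8126346690624, 8130373091328, 8134668059138, 8177618260224, 8177621926656, 8591008661504, 8591075444736, 15049566527488, 15049641951232, 15187037913280, 15187543326721, 15195661402240, 15204184227904, 15212790939648, 15256160043008, 15328738344960, 16355236126720, 16355261153280, 16836422795266, 35115652612096]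

set_option maxHeartbeats 400000000 in
/-- UNIT FACT (§B8 (ii)): every word of slice 177 passes the tower `nodeA`. -/
theorem unitsZ_177 : (SZ_177.map (bitsOf 45 0)).all nodeA = true := by decide +kernel

set_option maxHeartbeats 400000000 in
/-- BASE-SLICE FACT (§B9): slice 177 passes `sliceCheck` over `tab TE3 15` and has per-weight orbit-size sums `[0, 0, 0, 0, 0, 0, 9, 27, 349]`. -/
theorem baseZ_177 : sliceCheck (tab TE3 15) 3 3 5 9 SZ_177 = true ∧ osums 3 3 5 9 SZ_177 = [0, 0, 0, 0, 0, 0, 9, 27, 349] := by decide +kernel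

end Summit.Ventures.QEC.CircuitDistance.ETower.SecZ
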